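import Summits.CriticalPhenomena.SAWScalingLimit.Theorems.SAWTotalPositivityBoundaryTP2GeodesicTP2
import HarnessLib

/-!
# The two leading `x`-orders of the three-point splitting inequality never fail
# (crux `LeftRightFKG`, stmt-CriticalPhenomena-11232, line `corner-localisation`, skeleton v7, stub `stub_threePoint`)

Lead c2 (prover-line-stmt-CriticalPhenomena-11232-c2-0, 2026-08-17). The open stub `stub_threePoint = ThreePointAt x_c`
asserts `Z_H(w,p)·Z_H(w,q) ≤ Z_H(p,q)` for the fugacity-`x_c` self-avoiding path kernel. As `x → 0⁺` the two sides behave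
like `N(w,p)N(w,q)·x^{d(w,p)+d(w,q)}` and `N(p,q)·x^{d(p,q)}` (`d` = graph distance, `N(a,b)` = number of geodesics
`a → b`). This file records, on ANY simple graph (as the sibling's `FourPoint`/`GeodesicTP2` do for the TP₂ core), that
the comparison of these leading terms never fails:

* `dist_le_dist_add_dist'` — order 0: `d(p,q) ≤ d(w,p) + d(w,q)` (reverse a walk `w → p` and append a walk `w → q`);
* `threePoint_geodesicCount_mul_le` — order 1: in the equality case `d(p,q) = d(w,p) + d(w,q)`,
  `N(w,p)·N(w,q) ≤ N(p,q)`: the map `(α, β) ↦ α⁻¹ · β` sends a pair of geodesics to a walk `p → q` of length `d(p,q)`,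
  i.e. to a geodesic, injectively (`BoundaryTP2.walk_append_inj`, the split point being known from `|α| = d(w,p)`).

So a violation of the three-point inequality on a given graph can only occur at a fugacity bounded away from `0` — in
line with the lead's census, whose tightest instances are exactly equality cases of order 1 (`N(w,p)N(w,q) = N(p,q)`:
every geodesic `p → q` passes through `w`), decided at the next order with margins `~10⁻⁴` at small `x` and first failing
at `x ≈ .6`. Everything proved; Mathlib + the sibling's `walk_append_inj`. [folklore]
-/

namespace Summit.CriticalPhenomena.SAWScalingLimit.Theorems.LeftRightFKG.ThreePoint

open SimpleGraph

variable {V : Type*} {H : SimpleGraph V}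

/-- ORDER 0 (the exponents): `d(p,q) ≤ d(w,p) + d(w,q)` as soon as `w` reaches `p` and `q` (reverse-and-append two
geodesics). Mathlib's `Connected.dist_triangle` assumes connectivity of the whole graph; here only the two reachabilities
are used. [folklore] -/
theorem dist_le_dist_add_dist' {w p q : V} (hp : H.Reachable w p) (hq : H.Reachable w q) :
    H.dist p q ≤ H.dist w p + H.dist w q := by
  obtain ⟨α, hα⟩ := hp.exists_walk_length_eq_dist
  obtain ⟨β, hβ⟩ := hq.exists_walk_length_eq_dist
  have := dist_le (α.reverse.append β)
  rw [Walk.length_append, Walk.length_reverse, hα, hβ] at this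
  exact this

/-- ORDER 1 (the leading coefficients in the equality case): if `d(p,q) = d(w,p) + d(w,q)` then the numbers of
geodesics satisfy `N(w,p) · N(w,q) ≤ N(p,q)` — reversing a geodesic `w → p` and appending a geodesic `w → q` gives a
walk `p → q` of length `d(p,q)`, i.e. a geodesic, and the pair is recovered from it because the length of the first part
is `d(w,p)`. (`N(a,b) = #finsetWalkLength (dist a b) a b`; walks of length `dist` are self-avoiding paths,
`Walk.isPath_of_length_eq_dist`.) [folklore] -/
theorem threePoint_geodesicCount_mul_le [DecidableEq V] [H.LocallyFinite] (w p q : V)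
    (heq : H.dist p q = H.dist w p + H.dist w q) :
    (H.finsetWalkLength (H.dist w p) w p).card * (H.finsetWalkLength (H.dist w q) w q).card ≤
      (H.finsetWalkLength (H.dist p q) p q).card := by
  rw [← Finset.card_product]
  refine Finset.card_le_card_of_injOn (fun x : H.Walk w p × H.Walk w q => x.1.reverse.append x.2) ?_ ?_
  · rintro ⟨α, β⟩ hx
    simp only [Finset.coe_product, Set.mem_prod, Finset.mem_coe, mem_finsetWalkLength_iff] at hx
    simp only [Finset.mem_coe, mem_finsetWalkLength_iff, Walk.length_append, Walk.length_reverse]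
    omega
  · rintro ⟨α, β⟩ hx ⟨α', β'⟩ hx' h
    simp only [Finset.coe_product, Set.mem_prod, Finset.mem_coe, mem_finsetWalkLength_iff] at hx hx'
    have hl : α.reverse.length = α'.reverse.length := by
      rw [Walk.length_reverse, Walk.length_reverse, hx.1, hx'.1]
    obtain ⟨h₁, h₂⟩ := BoundaryTP2.walk_append_inj h hl
    have h₁' : α = α' := by simpa using congrArg Walk.reverse h₁
    have h₂' : β = β' := h₂
    rw [h₁', h₂']

/-- REGISTERED STUB `stub_threePointGeodesic` of line `corner-localisation` (lead c2): orders 0 and 1 in `x` of the open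
stub `stub_threePoint` never fail, on any locally finite simple graph with decidable equality on the sites of `ℤ²`:
the distance inequality, and the geodesic-count inequality in its equality case. [folklore] -/
theorem stub_threePointGeodesic : ∀ (H : SimpleGraph (Literature.Probability.LatticeModels.Site 2))
    [H.LocallyFinite] (w p q : Literature.Probability.LatticeModels.Site 2),
    (H.Reachable w p → H.Reachable w q → H.dist p q ≤ H.dist w p + H.dist w q) ∧
    (H.dist p q = H.dist w p + H.dist w q →
      (H.finsetWalkLength (H.dist w p) w p).card * (H.finsetWalkLength (H.dist w q) w q).card ≤
        (H.finsetWalkLength (H.dist p q) p q).card) := by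
  classical
  intro H _ w p q
  exact ⟨fun hp hq => dist_le_dist_add_dist' hp hq, fun heq => threePoint_geodesicCount_mul_le w p q heq⟩

end Summit.CriticalPhenomena.SAWScalingLimit.Theorems.LeftRightFKG.ThreePoint
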